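import Summits.QuantumFields.YangMills.Theses.ContractibleFibre
import Literature.MathematicalPhysics.QuantumLattice.LatticeGaugeDLR

/-!
# Sketch — crux idea `film-transition-sieve` for `FibreToTorus` (stmt-QuantumFields-16244)

Crux-ideate seat `planner-cruxidea-stmt-QuantumFields-16244-1-0` (round 1, ideator 1).  The statements below
elaborate over existing tree declarations only; nothing here is proved (idea stage, no skeleton).

* `plaqDensity`         — the total plaquette (action) density at the origin, `Σ_{i<j} Re tr ρ(U_{0,ij})`.
* `EnergyCoexistenceKink` — FIRST LEMMA of the line: two translation-invariant DLR states of the Wilson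
  specification at `β` with different mean plaquette density force a kink (non-differentiability in `β`) of the
  free energy density `freeEnergyDensity 4 ρ` (Friedli–Velenik Prop. 6.91, (6.117), for compact spins / finite
  range; Israel's tangent-functional theorem).  Contrapositive use: NO kink on an interval ⇒ all translation-
  invariant phases there share one action density (energy coexistence excluded).
* `KinkEnergyCoexistence` — the converse direction (6.118): a kink at `β` is realised by two translation-invariant
  (ergodic) DLR states `μ⁺, μ⁻` whose mean plaquette densities are the one-sided derivatives.
* `SlopeInheritance`     — the abstract convex-analysis core of "films inherit bulk kinks" (Griffiths' lemma):
  if convex `f_n → f` pointwise and `f` has a slope jump `Δ` at `x`, then for every `δ > 0` the chord-slope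
  increase of `f_n` across `[x-δ, x+δ]` is eventually `≥ Δ`.  (Pure real analysis; provable now from Mathlib's
  `ConvexOn` slope lemmas.)  Applied with `f_M = p_M/(M+1)²` (free-tube pressure per cross-section site) → `p`.
-/

noncomputable section

namespace Summit.QuantumFields.YangMills.Cruxes.FibreToTorus.FilmSieve

open scoped BigOperators Topology
open Filter Set MeasureTheory
open Literature.MathematicalPhysics.QuantumLattice (LGConfig IsZdTranslationInvariant plaquetteObs
  ymGibbsMeasures freeEnergyDensity)

variable {G : Type} [Group G] [TopologicalSpace G] [IsTopologicalGroup G] [CompactSpace G]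
  [MeasurableSpace G] [BorelSpace G] {N : ℕ}

/-- Total plaquette density at the origin: `Σ_{i<j} Re tr ρ(U_{0,ij})` (the `β`-derivative of the pressure is
an affine function of its mean in any translation-invariant state). -/
def plaqDensity (ρ : G →* Matrix (Fin N) (Fin N) ℂ) (U : LGConfig 4 G) : ℝ :=
  ∑ q : {q : Fin 4 × Fin 4 // q.1 < q.2}, plaquetteObs ρ 0 q.1.1 q.1.2 U

/-- **FIRST LEMMA — energy coexistence forces a kink.**  For a continuous faithful matrix representation `ρ` of
the compact group `G`: if two translation-invariant DLR states of the Wilson specification at `β` have different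
mean plaquette density, then `β ↦ freeEnergyDensity 4 ρ β` is not differentiable at `β`
(Friedli–Velenik Prop. 6.91 (6.117): `∂⁻ψ ≤ ⟨g⟩_μ ≤ ∂⁺ψ` for every translation-invariant Gibbs `μ`). -/
def EnergyCoexistenceKink : Prop :=
  ∀ (G : Type) [Group G] [TopologicalSpace G] [IsTopologicalGroup G] [CompactSpace G]
    [MeasurableSpace G] [BorelSpace G] (N : ℕ) (ρ : G →* Matrix (Fin N) (Fin N) ℂ),
    Continuous ρ → Function.Injective ρ →
    ∀ (β : ℝ) (μ ν : Measure (LGConfig 4 G)),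
      μ ∈ ymGibbsMeasures (d := 4) ρ β → ν ∈ ymGibbsMeasures (d := 4) ρ β →
      IsZdTranslationInvariant μ → IsZdTranslationInvariant ν →
      (∫ U, plaqDensity ρ U ∂μ) ≠ (∫ U, plaqDensity ρ U ∂ν) →
      ¬ DifferentiableAt ℝ (fun b : ℝ => freeEnergyDensity 4 ρ b) β

/-- **Converse (kink ⇒ energy coexistence).**  A point of non-differentiability of the free energy density is
realised by two translation-invariant DLR states with different mean plaquette density
(Friedli–Velenik Prop. 6.91 (6.118), Remark 6.92: they may be taken ergodic). -/
def KinkEnergyCoexistence : Prop :=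
  ∀ (G : Type) [Group G] [TopologicalSpace G] [IsTopologicalGroup G] [CompactSpace G]
    [MeasurableSpace G] [BorelSpace G] (N : ℕ) (ρ : G →* Matrix (Fin N) (Fin N) ℂ),
    Continuous ρ → Function.Injective ρ →
    ∀ β : ℝ, ¬ DifferentiableAt ℝ (fun b : ℝ => freeEnergyDensity 4 ρ b) β →
      ∃ μ ν : Measure (LGConfig 4 G),
        μ ∈ ymGibbsMeasures (d := 4) ρ β ∧ ν ∈ ymGibbsMeasures (d := 4) ρ β ∧
        IsZdTranslationInvariant μ ∧ IsZdTranslationInvariant ν ∧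
        (∫ U, plaqDensity ρ U ∂μ) < (∫ U, plaqDensity ρ U ∂ν)

/-- **Slope inheritance (Griffiths' lemma), abstract form.**  Convex functions converging pointwise inherit every
slope jump of the limit: if each `f n` is convex on `ℝ`, `f n x → g x` for all `x`, and the one-sided chord slopes
of `g` at `x₀` differ by at least `Δ` at scale `δ` (i.e. `(g(x₀+δ) - g x₀)/δ - (g x₀ - g(x₀-δ))/δ ≥ Δ`, which for
convex `g` with a derivative jump `Δ` at `x₀` holds for EVERY `δ > 0`), then eventually the same chord-slope increase
of `f n` is `≥ Δ - ε`.  With `f M = p_M/(M+1)²` (free-tube pressures per cross-section site) and `g = p` (bulk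
pressure) this is "thick films inherit bulk first-order kinks at scale `δ`". -/
def SlopeInheritance : Prop :=
  ∀ (f : ℕ → ℝ → ℝ) (g : ℝ → ℝ), (∀ n, ConvexOn ℝ Set.univ (f n)) →
    (∀ x, Tendsto (fun n => f n x) atTop (𝓝 (g x))) →
    ∀ (x₀ δ Δ ε : ℝ), 0 < δ → 0 < ε →
      Δ ≤ (g (x₀ + δ) - g x₀) / δ - (g x₀ - g (x₀ - δ)) / δ →
      ∀ᶠ n in atTop, Δ - ε ≤ (f n (x₀ + δ) - f n x₀) / δ - (f n x₀ - f n (x₀ - δ)) / δ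

/-- **Entry point on the crux side — HYP gives sharp action densities on the film tori.**  The crux's inline
free-tube predicate `Tube M β m C w Lmin` (copied verbatim) at slab width `w = 1` implies: on every width-`M`
tube with `L ≥ Lmin`, the empirical action density over the whole `(t,x)`-torus (total switched-on plaquette sum
divided by `L²`) has variance `≤ K/L²` for one `K = K(β, M, m, C)` — so the width-`M` FILM, read as a 2-d system in
`(t,x)`, carries no macroscopic phase mixture at `β` (the covariance of the cross-section action at `(0,0)` and at
`(n,k)` is `≤ 36(M+1)⁴ dim² · C e^{-m·max(n,|k|)}` by time-mixing and, via the `t ↔ x` symmetry of the tube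
measure, `x`-mixing; summable over the torus).  This is the statement that turns a film first-order point
(where symmetric tori ARE mixtures) into a violation of HYP. -/
def TubeSharpDensity : Prop :=
  ∀ (G : Type) [Group G] [TopologicalSpace G] [IsTopologicalGroup G] [CompactSpace G],
    Literature.MathematicalPhysics.QuantumFieldTheory.IsCompactSimpleLieGroup G →
    letI : MeasurableSpace G := borel G; haveI : BorelSpace G := ⟨rfl⟩;
    ∀ r : Literature.MathematicalPhysics.QuantumFieldTheory.LatticeRep G,
    let Tube := fun (M : ℕ) (β m C : ℝ) (w Lmin : ℕ) => ∀ (L : ℕ) [NeZero L], Lmin ≤ L → let St := ZMod L × ZMod L × Fin (M + 1) × Fin (M + 1); let Cfg := St × Fin 4 → G; let ν : MeasureTheory.Measure Cfg := MeasureTheory.Measure.pi fun _ => Literature.MathematicalPhysics.QuantumFieldTheory.haarProbability G; let sh : St → Fin 4 → St := fun x μ => ![(x.1 + 1, x.2.1, x.2.2.1, x.2.2.2), (x.1, x.2.1 + 1, x.2.2.1, x.2.2.2), (x.1, x.2.1, x.2.2.1 + 1, x.2.2.2), (x.1, x.2.1, x.2.2.1, x.2.2.2 + 1)] μ; let ins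 : St → Fin 4 → Fin 4 → ℝ := fun x μ κ => if ((μ = 2 ∨ κ = 2) → (x.2.2.1 : ℕ) < M) ∧ ((μ = 3 ∨ κ = 3) → (x.2.2.2 : ℕ) < M) then 1 else 0; let pl : Cfg → St → Fin 4 → Fin 4 → G := fun U x μ κ => U (x, μ) * U (sh x μ, κ) * (U (sh x κ, μ))⁻¹ * (U (x, κ))⁻¹; let act : Cfg → ℝ := fun U => β * ∑ x : St, ∑ q : {q : Fin 4 × Fin 4 // q.1 < q.2}, ins x q.1.1 q.1.2 * (r.ρ (pl U x q.1.1 q.1.2)).trace.re; let wgt : Cfg → ℝ := fun U => Real.exp (act U); let Ex : (Cfg → ℝ) → ℝ := fun F => (∫ U, F U * wgt U ∂ν) / (∫ U, wgt U ∂ν); let σ : ℕ → Cfg → Cfg := fun n U p => U ((p.1.1 + n, p.1.2), p.2); ∀ c : ZMod L, let Loc := fun F : Cfg → ℝ => Measurable F ∧ (∀ U, |F U| ≤ 1) ∧ ∀ U U', (∀ p : St × Fin 4, (p.1.1 - c).val ≤ w → U p = U' p) → F U = F U'; ∀ F₁ F₂ : Cfg → ℝ, Loc F₁ → Loc F₂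 → ∀ n : ℕ, 2 * n < L → |Ex (fun U => F₁ U * F₂ (σ n U)) - Ex F₁ * Ex (fun U => F₂ (σ n U))| ≤ C * Real.exp (-(m * n));
    ∀ (M : ℕ) (β m C : ℝ) (Lmin : ℕ), 0 < m → Tube M β m C 1 Lmin →
      ∃ K : ℝ, ∀ (L : ℕ) [NeZero L], Lmin ≤ L →
        let St := ZMod L × ZMod L × Fin (M + 1) × Fin (M + 1)
        let Cfg := St × Fin 4 → G
        let ν : MeasureTheory.Measure Cfg :=
          MeasureTheory.Measure.pi fun _ => Literature.MathematicalPhysics.QuantumFieldTheory.haarProbability G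
        let sh : St → Fin 4 → St := fun x μ => ![(x.1 + 1, x.2.1, x.2.2.1, x.2.2.2), (x.1, x.2.1 + 1, x.2.2.1, x.2.2.2), (x.1, x.2.1, x.2.2.1 + 1, x.2.2.2), (x.1, x.2.1, x.2.2.1, x.2.2.2 + 1)] μ
        let ins : St → Fin 4 → Fin 4 → ℝ := fun x μ κ =>
          if ((μ = 2 ∨ κ = 2) → (x.2.2.1 : ℕ) < M) ∧ ((μ = 3 ∨ κ = 3) → (x.2.2.2 : ℕ) < M) then 1 else 0
        let pl : Cfg → St → Fin 4 → Fin 4 → G := fun U x μ κ =>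
          U (x, μ) * U (sh x μ, κ) * (U (sh x κ, μ))⁻¹ * (U (x, κ))⁻¹
        let S : Cfg → ℝ := fun U =>
          ∑ x : St, ∑ q : {q : Fin 4 × Fin 4 // q.1 < q.2}, ins x q.1.1 q.1.2 * (r.ρ (pl U x q.1.1 q.1.2)).trace.re
        let wgt : Cfg → ℝ := fun U => Real.exp (β * S U)
        let Ex : (Cfg → ℝ) → ℝ := fun F => (∫ U, F U * wgt U ∂ν) / (∫ U, wgt U ∂ν)
        let dens : Cfg → ℝ := fun U => S U / ((L : ℝ) ^ 2)
        Ex (fun U => (dens U - Ex dens) ^ 2) ≤ K / ((L : ℝ) ^ 2)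

end Summit.QuantumFields.YangMills.Cruxes.FibreToTorus.FilmSieve

end
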